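import Summits.BirchSwinnertonDyer.Rank1Residual.X11b.RouteR1IMCEqFrame
import Summits.BirchSwinnertonDyer.Rank1Residual.X11b.RouteR1IntReceptacle
import HarnessLib

/-!
# X11b, route R1 at `p ≥ 5` — the open input in `R₀`-FREE FRAME FORM (H3∃♭): per datum ONE frame
# `Q ∈ 𝓞_{ℂ_p}⟦T⟧` with the interpolation property, the value at `𝟙` and the main-conjecture
# equality; the record on ALL of `R1Population ∩ {r_an = 1}` from 7 PUBLISHED + 5 CITED facts and it

HONEST FRAMING (cell `b2b-bsdres`, run/shared/lean/b2b/bsd-rank1-residual/, verbatim in every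
file): the goal of the cell is to DELETE the COMBINATION-SHAPED residual classes of the
Birch–Swinnerton-Dyer formula for ALL analytic-rank `≤ 1` elliptic curves over `ℚ` — "full BSD
formula for every rank `≤ 1` curve in class `C`" assembled STRICTLY from published theorems — so
that the rank-`≤ 1` remainder becomes exactly the CONSTRUCTION-SHAPED classes, which are TYPED
(missing-input `Prop`s), NOT attempted. This is not "finishing BSD". Sub-cell
`b2b-bsdres-multr1-p1` (X11b, route R1, gen 23); a RESEARCH ROUTE; no claim beyond the stated
class; X11b stays CONSTRUCTION-SHAPED; nothing here changes a label; ONE `Prop`-valued SHAPE with a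
body (nothing asserted) and theorems; no named fact; no `sorry`; every result using the OPEN shape is
CONDITIONAL.

## Why this file (x11b3-lead R7-61, 2026-08-21T09:56Z, CROSS-LANE NOTICE to the A206 consumers)

Gen 22's open input `R1.IMCEqFrameOnTree W p` (H3∃) asks, per datum, for a BDP frame
`(Ω_K, Ω_p ∈ R₀ˣ, L ∈ R₀⟦T⟧)`. x11b3-lit1's L59 flags at PRINT level that for fields `K` with
`k(K,p) ≥ 1` the printed construction of Castella's `L_p(f)` yields coefficients in a ramified ring
`𝒲 ⊋ R₀` and "`L_p(f) ∈ Λ_{R₀}`" rests on an unwritten descent (referee's call; no mark). The kernel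
inference to `BSD_p` never used `R₀`: it reads `ord_p` of a constant term in `ℂ_p`
(`RouteR1IntReceptacle.lean`). So the honest, MORE dischargeable attach point is the same frame over
Hsieh's receptacle `𝓞_{ℂ_p}⟦T⟧`:

* **`R1.IMCEqIntFrameOnTree W p`** (H3∃♭, OPEN shape, claim-tagged): at every datum of route R1 (as
  in H3∃), every anticyclotomic `(κ, γ)`, every embedding datum `ι'` and every `e : K → ℚ_p` inducing
  `𝔭_{ι'}`: THERE IS a frame `(Ω_K ≠ 0, Ω_p ∈ ℂ_p with ‖Ω_p‖ = 1, Q ∈ 𝓞_{ℂ_p}⟦T⟧)` with Castella's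
  interpolation property `R1.IsBDPLFunctionInt` ∧ the value at `𝟙` `R1.BDPValueAtOneIntAt` ∧ the
  main-conjecture equality `R1.IMCEqIntAt`.
* **`R1.imcEqIntFrameOnTree_of_imcEqFrame`**: H3∃ ⟹ H3∃♭ (read the `R₀`-frame in `𝓞_{ℂ_p}⟦T⟧`), so
  the new input is WEAKER than gen 22's (and than gen 21's: `…_of_thm32_of_imcEqOnTree`).
* **`R1.openInputOnTreeAt_of_imcEqIntFrame`** — `hmod`, `hGZK`, the five cited control facts, one
  datum `ι` and H3∃♭ ⟹ `R1OpenInputOnTreeAt W p` (gen 22's per-datum argument VERBATIM, the pointwise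
  assembly being `R1.imcWaldspurgerOnTreeAt_of_intHalves`); `…'` without the datum (Steinitz).
* **`R1.bsdp_of_imcEqIntFrame_record`** — THE RECORD: for every globally minimal elliptic `W/ℚ` and
  prime `p` on `R1Population` with `ord_{s=1} L(E,s) = 1`, `BSD(E,p)` from SEVEN PUBLISHED named facts
  (Gross–Zagier I.7.3, GZK, Skinner 2016 Thm. C, modularity, Cai–Shu–Tian, Friedberg–Hoffstein,
  Mazur's Manin constant), the FIVE CITED cohomological facts, and H3∃♭. WHAT IS OPEN in H3∃♭,
  honestly: exactly what is open in H3∃ (erratum Thm. 1.1 for Castella's `L_p(f)` ⇐ [FW21, Thm.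
  4.41], PREPRINT; on non-semistable pairs also the existence/value halves, PREPRINT) — MINUS the
  `R₀`-rationality of the frame, which no longer appears: a refereed statement about `L_p(f)` over
  `R₀`, over a finite extension `𝒲`, over `Z̄_p` or over `𝓞_{ℂ_p}` discharges it alike.

CONDITIONAL on H3∃♭ (open); deletes nothing; X11b stays CONSTRUCTION-SHAPED; no label change.

References: [Castella2018] Thms. 2.3, 3.1, 3.2, §5 (arXiv:1704.06608 pp. 5, 9, 12);
[Castella2018Erratum] Thm. 1.1 (p. 1); [Hsieh2014] Doc. Math. 19 (2014), Thm. 1, p. 7;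
[FouquetWan2021] Thm. 4.41.
-/

noncomputable section

open scoped Classical

open WeierstrassCurve NumberField IsDedekindDomain Field PowerSeries
open Literature.NumberTheory.EllipticCurves Literature.NumberTheory.EllipticCurves.GreenbergSelmer
open Literature.NumberTheory.EllipticCurves.ModularForms
open Literature.NumberTheory.EllipticCurves.Rank1Residual
open Literature.NumberTheory.EllipticCurves.Rank1Residual.Typed
open Literature.NumberTheory.EllipticCurves.Castella2018
open Literature.NumberTheory.GaloisRepresentations
open Literature.NumberTheory.GaloisCohomology
open Summit.BirchSwinnertonDyer.Rank1Residual.X11b.AcSelmer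
open Summit.BirchSwinnertonDyer.Rank1Residual.X11b.Halves

namespace Summit.BirchSwinnertonDyer.Rank1Residual.X11b

/-! ### §1 The open input in `R₀`-free frame form (H3∃♭) -/

section Shape

variable (W : WeierstrassCurve ℚ) [W.IsElliptic] [W.IsGloballyMinimal] (p : ℕ) [Fact p.Prime]

/-- **H3∃♭ — route R1's open input in `R₀`-FREE FRAME FORM (OPEN shape).** At every datum of route R1
read in the currency of the registered fact `Castella2018.thm32_exists_isBDPLFunction_valueAtOne` —
the A′-hypotheses `ErratumHypotheses W p`, `r_an = 1`, a non-split multiplicative `q ≠ p` with `E[p]`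
ramified (`p ∤ v_q(Δ)`), an erratum field `K` for `q` with [Cas20, §2.5]'s standing hypotheses at
the tame level, a parametrisation datum `Dt` at level `N_E` with `p ∤ c` (display (3.2)), a Heegner
datum `H`, a point `P` of infinite order with `P.map w₀.embedding = heegnerPointComplex Dt H` for an
infinite place `w₀` —, every anticyclotomic `ℤ_p`-extension `κ` with topological generator `γ`,
every embedding datum `ι' : ℚ̄_p ≃ ℂ` and every `e : K → ℚ_p` inducing the prime `𝔭_{ι'}`: THERE
EXISTS a frame `(Ω_K ≠ 0, Ω_p ∈ ℂ_p with ‖Ω_p‖ = 1, Q ∈ 𝓞_{ℂ_p}⟦T⟧)` with Castella's interpolation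
property `R1.IsBDPLFunctionInt p ι' 𝔭_{ι'} κ γ f Ω_K Ω_p Q` for the newform `f` of `Dt` [Cas18 Thm.
3.1, receptacle widened], the value at `𝟙` `Q(𝟙) = u·((1 − a_p(E) p⁻¹)·log_{ω_E} P)²`, `‖u‖ = 1`
[Cas18 Thm. 3.2, `R1.BDPValueAtOneIntAt`] and the main-conjecture EQUALITY
`Ch_Λ(X_ac^∅(E[p^∞]))·𝓞_{ℂ_p}⟦T⟧ = (Q)` at `𝔭_{ι'}` [erratum Thm. 1.1, `R1.IMCEqIntAt`]. The
∃∧-transcription of "Thm. 3.1 ∧ Thm. 3.2 ∧ erratum Thm. 1.1" (one object `L_p(f)`) with NO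
rationality clause on its coefficient ring: implied by gen 22's `R1.IMCEqFrameOnTree`
(`R1.imcEqIntFrameOnTree_of_imcEqFrame`). A predicate on `(W, p)`; NEVER a theorem in this cell; every
result using it is CONDITIONAL. [claim: Castella2018Erratum, status: under-review]
[cite: Castella2018, Thm. 3.1, display (3.2) and Thm. 3.2 (arXiv:1704.06608 p. 9) (shape only; nothing asserted)]
[cite: Hsieh2014, p. 7 (arXiv:1112.1580) (the receptacle `Z̄_p⟦Γ⁻⟧ ⊆ 𝓞_{ℂ_p}⟦T⟧`)] -/
def R1.IMCEqIntFrameOnTree : Prop :=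
  ∀ [NeZero (W.conductorNorm ℤ)] (q : ℕ) [Fact q.Prime] (K : Type) [Field K] [NumberField K]
    (Dt : ModularParametrizationData W (W.conductorNorm ℤ))
    (H : HeegnerDatum (W.conductorNorm ℤ) (NumberField.discr K)) (w₀ : InfinitePlace K)
    (P : (W.baseChange K).toAffine.Point), ErratumHypotheses W p → W.analyticRank = 1 →
    q ≠ p → Mult W q → ¬ W.HasSplitMultiplicativeReductionAtPrime q →
    ¬ p ∣ padicValInt q W.minimalDiscriminantInt → IsErratumField W K q →
    Cas20Standing K p (W.conductorNorm ℤ / p) →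
    WeierstrassCurve.Affine.Point.map w₀.embedding.toRatAlgHom P = heegnerPointComplex Dt H →
    ¬ (p : ℤ) ∣ Dt.c → ¬ IsOfFinAddOrder P →
    ∀ (κ : ZpExtension K p), κ.IsAnticyclotomic →
      ∀ (γ : Field.absoluteGaloisGroup K) [Fact (κ.IsTopGenerator γ)] (ι' : PadicAlgCl p ≃+* ℂ)
        (e : K →+* ℚ_[p]),
        (∀ k : 𝓞 K, k ∈ (primeOfEmbeddingDatum p ι' w₀.embedding).asIdeal ↔ ‖e (k : K)‖ < 1) →
        ∃ (ΩK : ℂ) (Ωp : ℂ_[p]) (Q : PowerSeries 𝓞_ℂ_[p]), ΩK ≠ 0 ∧ ‖Ωp‖ = 1 ∧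
          R1.IsBDPLFunctionInt p ι' (primeOfEmbeddingDatum p ι' w₀.embedding) κ γ Dt.f ΩK Ωp Q ∧
          R1.BDPValueAtOneIntAt W p e P Q (W.LFunction p) ∧
          R1.IMCEqIntAt W p κ (primeOfEmbeddingDatum p ι' w₀.embedding) γ Q

end Shape

/-! ### §2 H3∃♭ is weaker than gen 22's H3∃ (and than gen 21's inputs) -/

section FromGen22

variable {W : WeierstrassCurve ℚ} [W.IsElliptic] [W.IsGloballyMinimal] {p : ℕ} [Fact p.Prime]

/-- **H3∃ ⟹ H3∃♭.** Read the `R₀`-frame `(Ω_K, Ω_p ∈ R₀ˣ, L ∈ R₀⟦T⟧)` of gen 22's input in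
`𝓞_{ℂ_p}⟦T⟧` along `R₀ ⊆ 𝓞_{ℂ_p}` (`R1.unrToCpInt`): same values (`R1.isBDPLFunctionInt_map`,
`R1.bdpValueAtOneIntAt_map`), same ideal (`R1.imcEqIntAt_map`), `‖Ω_p‖ = 1` for a unit of `R₀`. So the
`R₀`-free input is implied by, and not stronger than, gen 22's. CONDITIONAL on H3∃ (open).
[cite: Castella2018, Thm. 3.1 and Thm. 3.2 (arXiv:1704.06608 p. 9)]
[cite: Castella2018Erratum, Thm. 1.1 (p. 1)] -/
theorem R1.imcEqIntFrameOnTree_of_imcEqFrame (h3 : R1.IMCEqFrameOnTree W p) :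
    R1.IMCEqIntFrameOnTree W p := by
  intro _ q _ K _ _ Dt H w₀ P hE hr hqp hmq hns hvq hK hCas hP hc hinf κ hκ γ _ ι' e he
  obtain ⟨ΩK, Ωp, L, hΩ, hL, h2, h3At⟩ :=
    h3 q K Dt H w₀ P hE hr hqp hmq hns hvq hK hCas hP hc hinf κ hκ γ ι' e he
  exact ⟨ΩK, ((Ωp : unrIntegers p) : ℂ_[p]), PowerSeries.map (R1.unrToCpInt p) L, hΩ,
    norm_coe_units_unrIntegers p Ωp, R1.isBDPLFunctionInt_map hL, R1.bdpValueAtOneIntAt_map h2,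
    R1.imcEqIntAt_map h3At⟩

/-- **`h32 ∧ H3 ⟹ H3∃♭` on a semistable pair** (through gen 22's
`R1.imcEqFrameOnTree_of_thm32_of_imcEqOnTree`): the `R₀`-free input is also weaker than gen 21's
inputs. CONDITIONAL on H3 (open). [cite: Castella2018, Thm. 3.1 and Thm. 3.2 (arXiv:1704.06608 p. 9)]
[cite: Castella2018Erratum, Thm. 1.1 (p. 1)] -/
theorem R1.imcEqIntFrameOnTree_of_thm32_of_imcEqOnTree
    (h32 : thm32_exists_isBDPLFunction_valueAtOne) (hss : Semistable W)
    (h3 : R1.IMCEqOnTree W p) : R1.IMCEqIntFrameOnTree W p :=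
  R1.imcEqIntFrameOnTree_of_imcEqFrame (R1.imcEqFrameOnTree_of_thm32_of_imcEqOnTree h32 hss h3)

end FromGen22

/-! ### §3 The open input of route R1 from H3∃♭ — no semistability, no `h32`, no `R₀` -/

section ClassLevel

variable {W : WeierstrassCurve ℚ} [W.IsElliptic] [W.IsGloballyMinimal] {p : ℕ} [Fact p.Prime]

/-- **Route R1's open input FROM H3∃♭ (any pair on the route, `p ≥ 5`).** Given `hmod` (modularity),
`hGZK`, the CITED cohomological facts of the control theorem (`hPT`, `hPT2`, `hEP`, `hcd`, `hBr` —
which make `R1ControlOnTreeAt W p` a THEOREM, gen 18), ONE embedding datum `ι : ℚ̄_p ≃ ℂ`, and the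
typed open input in `R₀`-free frame form H3∃♭: `R1OpenInputOnTreeAt W p`. Gen 22's per-datum argument
VERBATIM (`𝔭 = 𝔭_{ι'}` for `ι' ∈ {ι, ι ∘ conj}`; the datum's complex embedding is `w₀.embedding ∘ τ`
for a `τ ∈ Gal(K/ℚ)`, so `τ_* P` — again of infinite order — is the Heegner point in the fact's
reading; `embAt K p 𝔭` induces `𝔭`; CTL₀ from gen 18; `ord_p log_{ω_E}(τ_* P) = ord_p log_{ω_E} P`
since `rank_ℤ E(K) = 1`), the pointwise assembly now being `R1.imcWaldspurgerOnTreeAt_of_intHalves`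
over `𝓞_{ℂ_p}⟦T⟧`. NO semistability, NO `h32`, NO `R₀`-rationality is used. CONDITIONAL on H3∃♭
(open). [cite: Castella2018, Thms. 2.3, 3.1, 3.2 and §5 (arXiv:1704.06608 pp. 5, 9, 12)]
[cite: Castella2018Erratum, Thm. 1.1 (p. 1)] -/
theorem R1.openInputOnTreeAt_of_imcEqIntFrame
    (hmod : exists_isNewformOf) (hGZK : rank_eq_analyticRank_of_analyticRank_le_one)
    (hPT : ∀ (K : Type) [Field K] [NumberField K], poitouTate_selmerStructure_duality K)
    (hPT2 : ∀ (K : Type) [Field K] [NumberField K], poitouTate_sha_tateDual K)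
    (hEP : ∀ (K : Type) [Field K] [NumberField K] (v : HeightOneSpectrum (𝓞 K)),
      localEulerPoincareCharacteristic (v.adicCompletion K))
    (hcd : fieldCdLE_two_of_numberField)
    (hBr : ∀ (K : Type) [Field K] [NumberField K] (p : ℕ) [Fact p.Prime],
      ZpExtension.decomp_not_le_kerSubgroup_of_isAnticyclotomic K p)
    (ι : PadicAlgCl p ≃+* ℂ) (h3 : R1.IMCEqIntFrameOnTree W p) : R1OpenInputOnTreeAt W p := by
  intro _ q _ K _ _ Dt H ιK P hE hr hqp hmq hns hvq hK hCas hP hc hinf κ hκ γ _ 𝔭 h𝔭 he hf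
  have hC : R1ControlOnTreeAt W p :=
    r1ControlOnTreeAt_of_poitouTateAtoms_of_anticyclotomicDecomposition W p hBr
      (r1PoitouTateAtomsAt_of_twoAtoms W p hPT hEP
        (r1TwoAtomsAt_of_baseSelmerCount W p hPT hPT2 hEP hcd
          (r1BaseSelmerCountAt_of_facts W p hGZK hmod hPT hEP)))
  obtain ⟨n, hn, -⟩ := hC q K Dt H ιK P hE hr hqp hmq hns hvq hK hCas hP hc hinf κ hκ γ 𝔭 h𝔭 he hf
  obtain ⟨w₀⟩ := (inferInstance : Nonempty (InfinitePlace K))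
  have hnd : ¬ (p : ℤ) ∣ W.LFunction p := R1.not_dvd_lFunction_of_mult Dt.isNewformOf hE.2.1
  have hp2 : p ≠ 2 := by have := hE.1; omega
  -- `rank_ℤ E(K) = 1` on the erratum field (Gross–Zagier–Kolyvagin)
  have hrk : (W.baseChange K).mordellWeilRank = 1 :=
    (IsErratumField.mordellWeilRank_eq_one_and_shaFinite W hGZK hmod hr hK).1
  -- the datum's complex embedding is `w₀.embedding ∘ τ` for some `τ ∈ Gal(K/ℚ)`, `τ² = 1`
  haveI : IsGalois ℚ K := by
    haveI : Algebra.IsQuadraticExtension ℚ K := ⟨hK.1.1⟩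
    infer_instance
  obtain ⟨σ, hσ⟩ := ComplexEmbedding.exists_comp_symm_eq_of_comp_eq (k := ℚ) w₀.embedding ιK
    (by ext x; simp)
  set τ : K →+* K := ((σ.symm : K ≃ₐ[ℚ] K) : K →+* K) with hτdef
  have hτ : ∀ x, τ (τ x) = x := by
    intro x
    have hcard : Nat.card (K ≃ₐ[ℚ] K) = 2 := by rw [IsGalois.card_aut_eq_finrank, hK.1.1]
    have hsq : σ.symm * σ.symm = 1 := by
      have h := pow_card_eq_one' (G := K ≃ₐ[ℚ] K) (x := σ.symm)
      rwa [hcard, pow_two] at h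
    have := congrArg (fun g : K ≃ₐ[ℚ] K ↦ g x) hsq
    simpa [hτdef, AlgEquiv.mul_apply] using this
  -- the Galois conjugate `P' = τ_* P` is the Heegner point read through `w₀.embedding`
  set P' := WeierstrassCurve.Affine.Point.map τ.toRatAlgHom P with hP'def
  have hP' : WeierstrassCurve.Affine.Point.map w₀.embedding.toRatAlgHom P' =
      heegnerPointComplex Dt H := by
    rw [hP'def, WeierstrassCurve.Affine.Point.map_map]
    have hcomp : w₀.embedding.toRatAlgHom.comp τ.toRatAlgHom = ιK.toRatAlgHom := by
      apply AlgHom.ext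
      intro x
      have := RingHom.congr_fun hσ x
      simpa [hτdef] using this
    rw [hcomp]
    exact hP
  -- `P'` has infinite order too (`τ_*` is an injective group homomorphism)
  have hinf' : ¬ IsOfFinAddOrder P' := fun h ↦ hinf
    ((WeierstrassCurve.Affine.Point.map_injective (f := τ.toRatAlgHom)).isOfFinAddOrder_iff.mp
      (by simpa [hP'def] using h))
  -- `ord_p log P' = ord_p log P` along any embedding
  have hlog : ∀ e : K →+* ℚ_[p], padicLogOrd W p e P' = padicLogOrd W p e P := fun e ↦
    R1.padicLogOrd_map_eq_of_rank_one W p e P hp2 τ hτ hrk hinf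
  -- THE embedding at `𝔭` induces `𝔭`
  have hemb : ∀ k : 𝓞 K, k ∈ 𝔭.asIdeal ↔ ‖embAt K p 𝔭 h𝔭 he hf (k : K)‖ < 1 :=
    mem_asIdeal_iff_norm_embAt_lt_one 𝔭 h𝔭 he hf
  -- every degree-one prime above `p` is induced by `ι` or by `ι ∘ conj`
  have key : ∀ ι' : PadicAlgCl p ≃+* ℂ, 𝔭 = primeOfEmbeddingDatum p ι' w₀.embedding →
      IMCWaldspurgerOnTreeAt p κ 𝔭 γ (embAt K p 𝔭 h𝔭 he hf) P := by
    intro ι' h𝔭eq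
    subst h𝔭eq
    obtain ⟨ΩK, Ωp, Q, -, -, -, h2, h3At⟩ :=
      h3 q K Dt H w₀ P' hE hr hqp hmq hns hvq hK hCas hP' hc hinf' κ hκ γ ι' _ hemb
    refine R1.imcWaldspurgerOnTreeAt_of_padicLogOrd_eq W p _ (hlog _) ?_
    exact R1.imcWaldspurgerOnTreeAt_of_intHalves hn h3At hnd h2
  rcases eq_primeOfEmbeddingDatum_or_eq_trans_starRingAut p ι hK.1 w₀ h𝔭 with h | h
  · exact key ι h
  · exact key _ h

/-- **Route R1's open input from H3∃♭ — no embedding datum** (Steinitz: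
`PadicAlgCl.nonempty_ringEquiv_complex`). CONDITIONAL on H3∃♭ (open).
[cite: Castella2018, Thms. 2.3, 3.1, 3.2 and §5 (arXiv:1704.06608 pp. 5, 9, 12)]
[cite: Castella2018Erratum, Thm. 1.1 (p. 1)] -/
theorem R1.openInputOnTreeAt_of_imcEqIntFrame'
    (hmod : exists_isNewformOf) (hGZK : rank_eq_analyticRank_of_analyticRank_le_one)
    (hPT : ∀ (K : Type) [Field K] [NumberField K], poitouTate_selmerStructure_duality K)
    (hPT2 : ∀ (K : Type) [Field K] [NumberField K], poitouTate_sha_tateDual K)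
    (hEP : ∀ (K : Type) [Field K] [NumberField K] (v : HeightOneSpectrum (𝓞 K)),
      localEulerPoincareCharacteristic (v.adicCompletion K))
    (hcd : fieldCdLE_two_of_numberField)
    (hBr : ∀ (K : Type) [Field K] [NumberField K] (p : ℕ) [Fact p.Prime],
      ZpExtension.decomp_not_le_kerSubgroup_of_isAnticyclotomic K p)
    (h3 : R1.IMCEqIntFrameOnTree W p) : R1OpenInputOnTreeAt W p := by
  obtain ⟨ι⟩ := PadicAlgCl.nonempty_ringEquiv_complex p
  exact R1.openInputOnTreeAt_of_imcEqIntFrame hmod hGZK hPT hPT2 hEP hcd hBr ι h3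

/-- **Route R1 — THE RECORD IN `R₀`-FREE FRAME FORM (gen 23): all of `R1Population ∩ {r_an = 1}`,
`p ≥ 5`, 7 PUBLISHED + 5 CITED + ONE OPEN input, no semistability hypothesis, no auxiliary datum, no
rationality clause on the coefficient ring of the frame.** For every globally minimal elliptic `W/ℚ`
and prime `p` on `R1Population` with `ord_{s=1} L(E,s) = 1`: `BSD(E,p)`, from the SEVEN PUBLISHED named
facts `hGZ` (Gross–Zagier 1986 I.7.3), `hGZK` (Gross–Zagier–Kolyvagin), `hSk` (Skinner 2016 Thm. C),
`hmod` (modularity), `hCST` (Cai–Shu–Tian 2014 Thm. 1.1), `hFH` (Friedberg–Hoffstein 1995 Thm. B),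
`hMaz` (Mazur 1978 Cor. 4.1), the FIVE CITED cohomological facts `hPT hPT2 hEP hcd hBr`, and the ONE
OPEN input `h3 : R1.IMCEqIntFrameOnTree W p` (per datum: a frame `Q ∈ 𝓞_{ℂ_p}⟦T⟧` with Cas18 Thm.
3.1's interpolation property, Thm. 3.2's value at `𝟙` and erratum Thm. 1.1's main-conjecture
equality). HONEST CONTENT of the open input: on SEMISTABLE pairs its Thm. 3.1 ∧ 3.2 part is implied
by the registered published fact (read in `𝓞_{ℂ_p}⟦T⟧`) and what is open is erratum Thm. 1.1 for
Castella's `L_p(f)` (⇐ [FW21, Thm. 4.41], PREPRINT), over WHATEVER subring of `𝓞_{ℂ_p}` carries its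
coefficients; on NON-semistable pairs all three conjuncts are unrefereed ([Castella 2024, Thm. 3.1,
§2.3], PREPRINT). CONDITIONAL; deletes nothing; X11b stays CONSTRUCTION-SHAPED; no label change.
[cite: Castella2018, §5 (arXiv:1704.06608 p. 12)] [cite: Castella2018Erratum, Thm. 1.1, Thm. A′ (p. 1)] -/
theorem R1.bsdp_of_imcEqIntFrame_record
    (hGZ : GrossZagier1986_thm_I_7_3) (hGZK : rank_eq_analyticRank_of_analyticRank_le_one)
    (hSk : Skinner2016.thmC_padicValRat_bsd_rank_zero) (hmod : exists_isNewformOf)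
    (hCST : CaiShuTian2014.thm11_trivialChar)
    (hFH : friedbergHoffstein_exists_twist_ne_zero_ramifiedAt)
    (hMaz : mazur_not_dvd_maninConstant_of_odd)
    (hPT : ∀ (K : Type) [Field K] [NumberField K], poitouTate_selmerStructure_duality K)
    (hPT2 : ∀ (K : Type) [Field K] [NumberField K], poitouTate_sha_tateDual K)
    (hEP : ∀ (K : Type) [Field K] [NumberField K] (v : HeightOneSpectrum (𝓞 K)),
      localEulerPoincareCharacteristic (v.adicCompletion K))
    (hcd : fieldCdLE_two_of_numberField)
    (hBr : ∀ (K : Type) [Field K] [NumberField K] (p : ℕ) [Fact p.Prime],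
      ZpExtension.decomp_not_le_kerSubgroup_of_isAnticyclotomic K p)
    (h3 : R1.IMCEqIntFrameOnTree W p) (hW : R1Population W p) (hr : W.analyticRank = 1) :
    BSDp W p :=
  (R1.openInputOnTreeAt_iff_bsdp_final (W := W) (p := p) hGZ hGZK hSk hmod hCST hFH hMaz hPT hPT2
      hEP hcd hBr hW hr).mp
    (R1.openInputOnTreeAt_of_imcEqIntFrame' hmod hGZK hPT hPT2 hEP hcd hBr h3)

/-- **Both sides of gen 19's tightness hold under H3∃♭** on `R1Population ∩ {r_an = 1}`: the open
input `R1OpenInputOnTreeAt W p` AND `BSDp W p`. CONDITIONAL on H3∃♭ (open).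
[cite: Castella2018, §5 (arXiv:1704.06608 p. 12)] [cite: Castella2018Erratum, Thm. 1.1 (p. 1)] -/
theorem R1.openInput_and_bsdp_of_imcEqIntFrame_record
    (hGZ : GrossZagier1986_thm_I_7_3) (hGZK : rank_eq_analyticRank_of_analyticRank_le_one)
    (hSk : Skinner2016.thmC_padicValRat_bsd_rank_zero) (hmod : exists_isNewformOf)
    (hCST : CaiShuTian2014.thm11_trivialChar)
    (hFH : friedbergHoffstein_exists_twist_ne_zero_ramifiedAt)
    (hMaz : mazur_not_dvd_maninConstant_of_odd)
    (hPT : ∀ (K : Type) [Field K] [NumberField K], poitouTate_selmerStructure_duality K)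
    (hPT2 : ∀ (K : Type) [Field K] [NumberField K], poitouTate_sha_tateDual K)
    (hEP : ∀ (K : Type) [Field K] [NumberField K] (v : HeightOneSpectrum (𝓞 K)),
      localEulerPoincareCharacteristic (v.adicCompletion K))
    (hcd : fieldCdLE_two_of_numberField)
    (hBr : ∀ (K : Type) [Field K] [NumberField K] (p : ℕ) [Fact p.Prime],
      ZpExtension.decomp_not_le_kerSubgroup_of_isAnticyclotomic K p)
    (h3 : R1.IMCEqIntFrameOnTree W p) (hW : R1Population W p) (hr : W.analyticRank = 1) :
    R1OpenInputOnTreeAt W p ∧ BSDp W p :=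
  ⟨R1.openInputOnTreeAt_of_imcEqIntFrame' hmod hGZK hPT hPT2 hEP hcd hBr h3,
    R1.bsdp_of_imcEqIntFrame_record hGZ hGZK hSk hmod hCST hFH hMaz hPT hPT2 hEP hcd hBr h3 hW hr⟩

end ClassLevel

end Summit.BirchSwinnertonDyer.Rank1Residual.X11b

end
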